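import Summits.KontsevichZagierPeriods.Zeta5Search.LaiSweepShard

/-!
# `κ₃` sweep certificate — shard file 018 of 127 (shards 126–132 of 889)

HONEST FRAMING. Systematic search; no irrationality claim unless certified. This file only checks,
by `decide +kernel`, shards 126–132 of the order-cell sweep of the `κ₃` point `(74, 2180, 444; δ74)`
(engine `LaiSweepEngine`, soundness `LaiSweepJump/Free/Eval/Shard/Kappa3`; a shard is `⟨regime, n,
p, q, p', q', Lo, Up⟩`: `n` cells from `p/q` to `p'/q'` with integer rate sums in `[Lo, Up]`, `K =
128`, `D = 2^40`). It draws NO conclusion: only the capstone `LaiKappa3SweepCert`, which needs all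
127 shard files, does. Kernel cost of this file ≈ 560 cells × 0.3 s.
-/

namespace Summit.KontsevichZagierPeriods.Zeta5Search.Sweep

set_option maxHeartbeats 100000000 in
/-- Shard 126: 80 cells of regime B from `13/322` to `17/409`.
[cite: Lai2024BallRivoal, §4 Lemma 4.3] -/
theorem shard126 :
    Shard.check 128 (2^40)
      ⟨true, 80, 13, 322, 17, 409, 163329686913625, 163533484564518⟩ = true := by
  decide +kernel

set_option maxHeartbeats 100000000 in
/-- Shard 127: 80 cells of regime B from `17/409` to `13/303`.
[cite: Lai2024BallRivoal, §4 Lemma 4.3] -/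
theorem shard127 :
    Shard.check 128 (2^40)
      ⟨true, 80, 17, 409, 13, 303, 178094166860009, 178361080080213⟩ = true := by
  decide +kernel

set_option maxHeartbeats 100000000 in
/-- Shard 128: 80 cells of regime B from `13/303` to `53/1201`.
[cite: Lai2024BallRivoal, §4 Lemma 4.3] -/
theorem shard128 :
    Shard.check 128 (2^40)
      ⟨true, 80, 13, 303, 53, 1201, 156817777057154, 157049865831523⟩ = true := by
  decide +kernel

set_option maxHeartbeats 100000000 in
/-- Shard 129: 80 cells of regime B from `53/1201` to `15/331`.
[cite: Lai2024BallRivoal, §4 Lemma 4.3] -/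
theorem shard129 :
    Shard.check 128 (2^40)
      ⟨true, 80, 53, 1201, 15, 331, 147768068370712, 147968988789369⟩ = true := by
  decide +kernel

set_option maxHeartbeats 100000000 in
/-- Shard 130: 80 cells of regime B from `15/331` to `11/236`.
[cite: Lai2024BallRivoal, §4 Lemma 4.3] -/
theorem shard130 :
    Shard.check 128 (2^40)
      ⟨true, 80, 15, 331, 11, 236, 155625265578358, 155883670066175⟩ = true := by
  decide +kernel

set_option maxHeartbeats 100000000 in
/-- Shard 131: 80 cells of regime B from `11/236` to `115/2402`.
[cite: Lai2024BallRivoal, §4 Lemma 4.3] -/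
theorem shard131 :
    Shard.check 128 (2^40)
      ⟨true, 80, 11, 236, 115, 2402, 148414082134441, 148660545072592⟩ = true := by
  decide +kernel

set_option maxHeartbeats 100000000 in
/-- Shard 132: 80 cells of regime B from `115/2402` to `14/285`.
[cite: Lai2024BallRivoal, §4 Lemma 4.3] -/
theorem shard132 :
    Shard.check 128 (2^40)
      ⟨true, 80, 115, 2402, 14, 285, 141751390507983, 141972473079056⟩ = true := by
  decide +kernel

/-- The checked shards of this file, in order. [folklore] -/
def shards018 : List (CheckedShard 128 (2^40)) :=
  [⟨_, shard126⟩, ⟨_, shard127⟩, ⟨_, shard128⟩, ⟨_, shard129⟩, ⟨_, shard130⟩,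
    ⟨_, shard131⟩, ⟨_, shard132⟩]

end Summit.KontsevichZagierPeriods.Zeta5Search.Sweep
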